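import Summits.ValiantsHypothesis.ValiantsHypothesis.Theses.RealTau
import Literature.Computability.AlgebraicComplexity.RealTauKnownCases

/-!
# `RealTau.RealTauRefined` (stmt-ValiantsHypothesis-18101) — negative side, II: small models behind the
# calibration "additive count" (zeros of a sum of products exceed the sum of the zeros of the products)

Refuter (cdisprove cycle 1, 2026-08-17), from `Cruxes/RealTauRefined/Disproof.lean` Part II §(k).
`Disproof.lean` records the calibration conjecture ADDITIVE COUNT — a nonzero `(k,m,t)` expression has at
most `k m (t-1) + k - 1` zeros in `(0,∞)` (sharp at `m = 1` and `k = 1`; implies the crux with `a = 2`,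
proved there; attained for all `k, m ≥ 1, t ≥ 2` by scale separation, on paper; never exceeded by the
numerical searches kit j023898/899/901, j024061/072/175) — and, for sums of `K` signed EVEN powers of
`T`-nomials, the m-uniform count `2KT - K - 1` (attained for every even `m` by an explicit family; odd powers
can do more, e.g. 9 > 8 at `(K,T,m) = (3,2,5)`, job j024175).  Kernel-checked here (no facts, no `def`s):

* `le_card_pos_roots_of_alternating` — reusable certificate: sign alternation of `F.eval` along an
  increasing list of positive points gives that many distinct positive zeros (IVT);
* `additiveCount_attained_2_2_2` — two products of two binomials with `5 = k m (t-1) + k - 1` distinct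
  positive zeros (each product has 2; Descartes allows 7): the interaction term `k - 1` is real, no valid
  bound is subadditive over the summands, and the additive count is sharp at `(2,2,2)`;
* `waringCount_attained_3_2_2` — three signed squares of binomials (`K = 3, T = 2, m = 2`) with `8 =
  2KT - K - 1` distinct positive zeros, the base case of the m-uniform family
  `G_m = -(x-1)^m + (x²(x-100)/10³)^m - (x⁶(x-10⁴)/10¹⁶)^m` (8 positive zeros for every even `m`,
  exact arithmetic / dominant-base comparison, `Disproof.lean` §(k)).
[folklore]
-/

set_option linter.dupNamespace false

namespace Summit.ValiantsHypothesis.ValiantsHypothesis.Theorems.RealTauRefined.Negative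

open Polynomial Finset
open Literature.Computability.AlgebraicComplexity
open Summit.ValiantsHypothesis.ValiantsHypothesis.Theses.RealTau

/-! ### sign-alternation certificate and the two instances -/

/-- SIGN-ALTERNATION CERTIFICATE: if `F.eval` takes values of opposite signs at consecutive points of an
increasing list `x₀ < x₁ < ⋯ < xₙ` of positive reals, then `F` has at least `n` distinct zeros in `(0,∞)`
(IVT on each `[xᵢ, xᵢ₊₁]`; consecutive zeros are separated by the `xᵢ`). [folklore] -/
theorem le_card_pos_roots_of_alternating (F : ℝ[X]) {n : ℕ} (x : Fin (n + 1) → ℝ)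
    (hx : StrictMono x) (h0 : 0 < x 0)
    (halt : ∀ i : Fin n, F.eval (x i.castSucc) * F.eval (x i.succ) < 0) :
    n ≤ (F.roots.toFinset.filter (0 < ·)).card := by
  rcases Nat.eq_zero_or_pos n with rfl | hn
  · exact Nat.zero_le _
  have hF0 : F ≠ 0 := by
    intro h
    have := halt ⟨0, hn⟩
    rw [h, eval_zero, eval_zero, mul_zero] at this
    exact lt_irrefl _ this
  have hroot : ∀ i : Fin n, ∃ r, x i.castSucc < r ∧ r < x i.succ ∧ F.eval r = 0 := by
    intro i
    have hab : x i.castSucc ≤ x i.succ := (hx Fin.castSucc_lt_succ).le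
    rcases mul_neg_iff.mp (halt i) with ⟨ha, hb⟩ | ⟨ha, hb⟩
    · obtain ⟨r, ⟨hr1, hr2⟩, hr⟩ := intermediate_value_Ioo' hab F.continuous.continuousOn
        (show (0 : ℝ) ∈ Set.Ioo _ _ from ⟨hb, ha⟩)
      exact ⟨r, hr1, hr2, hr⟩
    · obtain ⟨r, ⟨hr1, hr2⟩, hr⟩ := intermediate_value_Ioo hab F.continuous.continuousOn
        (show (0 : ℝ) ∈ Set.Ioo _ _ from ⟨ha, hb⟩)
      exact ⟨r, hr1, hr2, hr⟩
  choose r hr1 hr2 hr0 using hroot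
  have hlt : ∀ i j : Fin n, i < j → r i < r j := fun i j hij =>
    calc r i < x i.succ := hr2 i
      _ ≤ x j.castSucc := hx.monotone (by
          rw [Fin.le_iff_val_le_val, Fin.val_succ, Fin.val_castSucc]
          exact Fin.lt_def.mp hij)
      _ < r j := hr1 j
  have hinj : Function.Injective r := fun i j h => by
    rcases lt_trichotomy i j with hij | hij | hij
    · exact absurd h (hlt i j hij).ne
    · exact hij
    · exact absurd h (hlt j i hij).ne'
  have hsub : Finset.univ.image r ⊆ F.roots.toFinset.filter (0 < ·) := by
    intro y hy
    obtain ⟨i, -, rfl⟩ := Finset.mem_image.mp hy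
    refine mem_filter.mpr ⟨Multiset.mem_toFinset.mpr ((mem_roots hF0).mpr (IsRoot.def.mpr (hr0 i))), ?_⟩
    exact h0.trans_le ((hx.monotone (Fin.zero_le _)).trans (hr1 i).le)
  calc n = (Finset.univ.image r).card := by
        rw [Finset.card_image_of_injective _ hinj, Finset.card_univ, Fintype.card_fin]
    _ ≤ _ := card_le_card hsub

/-- A binomial written as `C a * X ^ p + C b * X ^ q` has at most two monomials. [folklore] -/
theorem card_support_binom_le (a b : ℝ) (p q : ℕ) :
    (C a * X ^ p + C b * X ^ q).support.card ≤ 2 :=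
  (card_le_card support_add).trans ((card_union_le _ _).trans
    (Nat.add_le_add card_support_C_mul_X_pow_le_one card_support_C_mul_X_pow_le_one))

/-- THE ADDITIVE COUNT IS ATTAINED AT `(k,m,t) = (2,2,2)` (kernel-checked instance of the scale-separation
construction): a sum of two products of two real binomials with `5 = k m (t-1) + k - 1` distinct POSITIVE
zeros — Descartes allows 7, each product alone has 2, so the zeros of a sum of products EXCEED the sum of
the zeros of the products (the interaction term `k - 1` is real; numerically 5 is also the maximum found,
kit j023898/j024072).  Witness `F = 10¹²(X-1)(X-2) - X⁴(X-10⁴)(X-2·10⁴)`: products dominant on separated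
scales, sign pattern `+ - + - + -` at `x = 1/2, 3/2, 3, 100, 15000, 30000`. [folklore] -/
theorem additiveCount_attained_2_2_2 : ∃ f : Fin 2 → Fin 2 → Polynomial ℝ,
    (∀ i j, (f i j).support.card ≤ 2) ∧ (∑ i, ∏ j, f i j) ≠ 0 ∧
      5 ≤ ((∑ i, ∏ j, f i j).roots.toFinset.filter (0 < ·)).card := by
  let W : Fin 2 → Fin 2 → ℝ[X] :=
    ![![C ((10 : ℝ) ^ 12) * X ^ 1 + C (-(10 : ℝ) ^ 12) * X ^ 0, C 1 * X ^ 1 + C (-2) * X ^ 0],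
      ![C (-1) * X ^ 5 + C 10000 * X ^ 4, C 1 * X ^ 1 + C (-20000) * X ^ 0]]
  have hsparse : ∀ i j, (W i j).support.card ≤ 2 := by
    intro i j
    fin_cases i <;> fin_cases j <;> exact card_support_binom_le _ _ _ _
  have heval : ∀ x : ℝ, (∑ i, ∏ j, W i j).eval x =
      ((10 : ℝ) ^ 12 * x - 10 ^ 12) * (x - 2) + (-x ^ 5 + 10000 * x ^ 4) * (x - 20000) := by
    intro x
    simp [W, Fin.sum_univ_two, Fin.prod_univ_two]
    ring
  refine ⟨W, hsparse, ?_, ?_⟩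
  · intro h
    have := heval (1 / 2)
    rw [h, eval_zero] at this
    norm_num at this
  · refine le_card_pos_roots_of_alternating _ ![1 / 2, 3 / 2, 3, 100, 15000, 30000] ?_ (by norm_num) ?_
    · refine Fin.strictMono_iff_lt_succ.mpr fun i => ?_
      fin_cases i <;> simp <;> norm_num
    · intro i
      rw [heval, heval]
      fin_cases i <;> simp <;> norm_num

/-- THE WARING COUNT `2KT - K - 1` IS ATTAINED AT `(K, T, m) = (3, 2, 2)` (kernel-checked base case of the
m-uniform family `G_m = -(x-1)^m + (x²(x-100)/10³)^m - (x⁶(x-10⁴)/10¹⁶)^m` of `Disproof.lean` §(k), scaled by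
`10³²`): `G = -(10¹⁶(X-1))² + (10¹³X³ - 10¹⁵X²)² - (X⁷ - 10⁴X⁶)²`, a sum of three signed squares of binomials
(a `(3,2,2)` expression), has `≥ 8` distinct positive zeros — sign pattern `- + - + - + - + -` at
`x = 1/2, 1, 3/2, 20, 100, 120, 8000, 10⁴, 1.2·10⁴`; 8 is also Descartes' cap here and the maximum found
numerically for every even `m ≤ 12` (kit j023901). [folklore] -/
theorem waringCount_attained_3_2_2 : ∃ f : Fin 3 → Fin 2 → Polynomial ℝ,
    (∀ i j, (f i j).support.card ≤ 2) ∧ (∑ i, ∏ j, f i j) ≠ 0 ∧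
      8 ≤ ((∑ i, ∏ j, f i j).roots.toFinset.filter (0 < ·)).card := by
  let W : Fin 3 → Fin 2 → ℝ[X] :=
    ![![C (-(10 : ℝ) ^ 16) * X ^ 1 + C ((10 : ℝ) ^ 16) * X ^ 0, C ((10 : ℝ) ^ 16) * X ^ 1 + C (-(10 : ℝ) ^ 16) * X ^ 0],
      ![C ((10 : ℝ) ^ 13) * X ^ 3 + C (-(10 : ℝ) ^ 15) * X ^ 2, C ((10 : ℝ) ^ 13) * X ^ 3 + C (-(10 : ℝ) ^ 15) * X ^ 2],
      ![C (-1) * X ^ 7 + C 10000 * X ^ 6, C 1 * X ^ 7 + C (-10000) * X ^ 6]]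
  have hsparse : ∀ i j, (W i j).support.card ≤ 2 := by
    intro i j
    fin_cases i <;> fin_cases j <;> exact card_support_binom_le _ _ _ _
  have heval : ∀ x : ℝ, (∑ i, ∏ j, W i j).eval x =
      -((10 : ℝ) ^ 16 * x - 10 ^ 16) ^ 2 + (10 ^ 13 * x ^ 3 - 10 ^ 15 * x ^ 2) ^ 2
        - (x ^ 7 - 10000 * x ^ 6) ^ 2 := by
    intro x
    simp [W, Fin.sum_univ_three, Fin.prod_univ_two]
    ring
  refine ⟨W, hsparse, ?_, ?_⟩
  · intro h
    have := heval 1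
    rw [h, eval_zero] at this
    norm_num at this
  · refine le_card_pos_roots_of_alternating _
      ![1 / 2, 1, 3 / 2, 20, 100, 120, 8000, 10000, 12000] ?_ (by norm_num) ?_
    · refine Fin.strictMono_iff_lt_succ.mpr fun i => ?_
      fin_cases i <;> simp <;> norm_num
    · intro i
      rw [heval, heval]
      fin_cases i <;> simp <;> norm_num

end Summit.ValiantsHypothesis.ValiantsHypothesis.Theorems.RealTauRefined.Negative
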